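import Literature.AlgebraicGeometry.CossartPiltant200819.TamePrimeDescentAssembly2008
import Literature.AlgebraicGeometry.Resolution.QuadraticTransforms
import HarnessLib

/-!
# Cossart–Piltant 2008, Lemma 9.4 in rational rank one: the DISCRETE case over a PERFECT ground
# field via uniformization along arcs (Benito–Piltant–Reguera 2022, Prop. 2.3)

Topic: `Literature/AlgebraicGeometry/CossartPiltant200819` (sources [CossartPiltant2008] =
HAL hal-00139124v1 and [BenitoPiltantReguera2022] = J. Pure Appl. Algebra 226 (2022) 107110,
read in its HAL version hal-01945228v1 (5 Dec 2018), whose page and item numbers are quoted).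
Companion of `DiscreteDescent2008.lean` (not imported); nothing of the A21.S cluster is edited.

## What this module is about

`PrimaryContraction2008.lean` isolates the last dependency of CP 2008 Lemma 9.4
(`TamePrimeDescent`) on the unprinted stability statement (S3\*) (HAL p. 30, l. 14–16) as the
residual `GStableUniformizationInertialRankOne`: for the inertial (`G_i(W/V) = G`) rank-one `W`
with `rat.rk W < 2`, every normal local model `R₀` of `V = W ∩ K` admits a `G`-STABLE local
uniformization `S ⊇ R̃₀` of `W`.  `DiscreteDescent2008.lean` removed from it the sub-case
"`V` discrete with finite separable residue extension" at the level of the LEMMA (Knaf–Kuhlmann).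
THIS module settles the residual ITSELF — the `G`-stable uniformization — in the sub-case

> `W` is a discrete valuation ring (value group `ℤ`) and the ground field `k` is perfect,

from one printed, refereed theorem, by an argument that is pure bookkeeping once that theorem is
available: **point blow-ups along a `G`-invariant valuation are `G`-equivariant.**

## What the source prints (verified on the page)

[BenitoPiltantReguera2022], §2 (HAL p. 4): "Let `k` be a perfect field. By a variety over `k`, we
mean a reduced separated `k`-scheme of finite type. Given a variety `X|k`, let `X_∞|k` denote the
space of arcs of `X`."  Definition 2.1 (HAL p. 6): "Given `P ∈ X_∞`, with residue field `κ(P)`, we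
denote by `h_P : Spec κ(P)[[t]] → X` the induced `κ(P)`-arc on `X`. … The point `h_P(0) ∈ X` is
called the center of `h_P`. … We denote by `v_P` the order function `ord_t h_P^♯`. The arc `h_P`
is said to be nonconstant if `h_P(η) ≠ h_P(0)`. … Let `π : X' → X` be a blowing up along a
subscheme `Y ⊂ X` such that `h_P(η) ∉ Y`. There exists a unique lifting `h'_P`. … Iterating, let
`X ← X' ← ⋯ ← X^{(r)} ← ⋯` (2.2) be the resulting sequence of blowing ups and centers … An
important case of such sequences is when taking `Y^{(r)} = {x^{(r)}}` for every `r ≥ 0`; then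
(2.2) is called the quadratic sequence along `h_P`."

> **Proposition 2.3 (Uniformization along arcs).** "Let `P ∈ X_∞`. Assume that `h_P` is a
> nonconstant arc and `h_P(η) ∉ Sing X`. Consider the quadratic sequence (2.2) and let
> `π^{(r)} : X^{(r)} → X` and `h^{(r)}_P : Spec κ(P)[[t]] → X^{(r)}` be the corresponding
> morphisms for `r ≥ 0`. Then both `Γ(h^{(r)}_P)` and `X^{(r)}` are regular at `x^{(r)}` for
> every `r ≫ 0`."  [cite: BenitoPiltantReguera2022, Prop. 2.3 (HAL hal-01945228v1 p. 7)]

(The proof, HAL p. 7–9: "To prove the statement for `Γ(h^{(r)}_P)`, it can be assumed without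
loss of generality that `Γ(h_P) = X`. We build up a discrete invariant
`i(x) := (a(x), b(x), e(x), δ(x)) ∈ ℕ⁴` which decreases for the lexicographical ordering by
blowing up along `x` provided `𝒪_{X,x}` is not regular", with
`δ(x) := min{v(D·f) : D ∈ Δ(x), f ∈ P, D·f ∉ P}` and "Note that since `k` is perfect, `X` is
generically smooth over `k`, so there exists `f ∈ P` and `D ∈ Δ(x)` such that `Df ∉ P`. In
particular, we have `δ(x) < +∞`"; it ends "The proof of the proposition for `X^{(r)}` is
similar." — for the arcs used below `Γ(h_P) = X`, so only the fully written case is invoked.)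

## Lean rendering of Prop. 2.3 (NAMED FACT `BenitoPiltantReguera2022QuadraticSequence`)

We vendor the special case in which the arc is THE ARC OF A DISCRETE VALUATION RING `O ⊇ k` of
the function field `K = k(X)` itself: for `k` perfect, `κ(O)/k` is separable, so the completion
`Ô ≅ κ(O)[[t]]` has a coefficient field containing `k` (Cohen; Matsumura, CRT Thm. 28.3) and
`𝒪_X → O → Ô ≅ κ(O)[[t]]` is a `κ(O)`-point `P` of `X_∞` with `v_P = v_O`, nonconstant, with
`h_P(η)` the generic point of `X` (so `h_P(η) ∉ Sing X` and `Γ(h_P) = X`: only the first, fully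
written, half of the printed proof is used).  For `X = Spec A` an affine model of a local model
`R₀ = A_𝔭` of `O` (`IsLocalModelOf`, `LocalModels2008.lean`), the local rings `𝒪_{X^{(r)},x^{(r)}}`
of the quadratic sequence along `h_P` at its centres are, inside `K`, the successive QUADRATIC
TRANSFORMS of `R₀` ALONG `O` (`Resolution.IsQuadraticTransformAlong`, `QuadraticTransforms.lean`:
`R_{i+1} = (R_i[𝔪_i/x_i])_{𝔪_O ∩ R_i[𝔪_i/x_i]}`, `x_i ∈ 𝔪_i` of minimal value; unique given `R_i`
and `O`, `IsQuadraticTransformAlong.unique`), and "`X^{(r)}` regular at `x^{(r)}`" says that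
`R_r` — a local ring of the `k`-variety `X^{(r)}` dominated by `O`, i.e. a local model of `O` — is
a regular local ring: a local uniformization of `O` (`IsLocalUniformizationOf`).  We state the
conclusion in `∃`-form ("some finite chain of quadratic transforms along `O` starting at `R₀`
ends at a local uniformization of `O`"), which the printed statement implies (the chain being
unique, it IS the printed quadratic sequence).  Hypothesis only; users take
`(h : BenitoPiltantReguera2022QuadraticSequence)`.

## What is PROVED here (bookkeeping)

* `quadraticTransform_map_eq_self` — **equivariance of quadratic transforms**: if a field
  automorphism `σ` fixes the valuation ring `W` (`σW = W`) and the local ring `R ⊆ W` dominated by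
  `W` (`σR = R`), then it fixes the quadratic transform of `R` along `W` (transport of structure +
  `IsQuadraticTransformAlong.unique`);
* `isLocallyUniformizable_of_isDiscreteValuationRing` — over a perfect ground field every
  DISCRETE valuation ring of a function field (any dimension, any characteristic, any residue
  field) admits local uniformization [BPR 2022, Prop. 2.3] (compare Knaf–Kuhlmann 2009 Thm. 1.5,
  `DiscreteSeparableResidueLocalUniformization.lean`, which needs the residue field extension
  finite separable but allows imperfect `k`);
* `gStableUniformizationAbove_of_isDiscreteValuationRing` — **(S3\*) in the discrete case over a
  perfect field**: for `L/K` finite, `W` a discrete valuation ring of `L` over `k` fixed by every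
  `σ ∈ Aut(L/K)`, and ANY normal local model `R₀` of `V = W ∩ K`, there is a local uniformization
  `S ⊇ R̃₀` of `W` with `σS = S` for all `σ`: start the quadratic sequence along `W` at the local
  ring of `W` on the `Aut(L/K)`-saturation of an affine model of a local model `T ⊇ R̃₀`
  (`normalModelAboveLe_holds`), and use equivariance at each step.  No inertia, primality,
  `rat.rk`, residue or local-uniformizability hypothesis is needed;
* the DICHOTOMY of the residual: `GStableUniformizationInertialRankOne` follows from
  [BPR 2022, Prop. 2.3] together with its two printed-theorem-free sub-cases
  `GStableUniformizationInertialRankOneNonDiscrete` (`W` not discrete, i.e. value group a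
  non-discrete subgroup of `ℚ`: the genuinely open case, any `k`) and
  `GStableUniformizationInertialRankOneDiscreteImperfect` (`W` discrete, `k` not perfect)
  (`gStableUniformizationInertialRankOne_of_cases`), whence Lemma 9.4 from the printed leaves and
  these (`tamePrimeDescent_of_printed_leaves_cases`).  (In universe `0` the second sub-case
  shrinks further — `k` imperfect, `W` discrete AND `κ(V)/k` not finite separable — by composing
  with `DiscreteDescent2008.tamePrimeDescent_of_printed_leaves_core` [KnafKuhlmann2009, Thm. 1.5];
  that one-line composition is not repeated here, this module importing only
  `TamePrimeDescentAssembly2008`.)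

Scope of the printed source vs. this rendering: [BPR 2022] is stated for arbitrary points of the
arc space of a variety over a perfect field; we use only arcs of discrete valuation rings of the
function field through the generic point.  The gap (S3\*) itself (HAL p. 30 l. 14–16, any `k`,
`W` of rational rank one NON-discrete) is untouched: hypothesis only.

## References

* [BenitoPiltantReguera2022] A. Benito, O. Piltant, A. J. Reguera, *Small irreducible components of
  arc spaces in positive characteristic*, J. Pure Appl. Algebra 226 (2022) 107110
  (doi:10.1016/j.jpaa.2022.107110); HAL hal-01945228v1, §2, Def. 2.1, Prop. 2.3 (p. 4–9).
* [CossartPiltant2008] V. Cossart, O. Piltant, *Resolution of singularities of threefolds in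
  positive characteristic I*, HAL hal-00139124v1, Lemma 9.4 and its proof (p. 29–30).
* [KnafKuhlmann2009] H. Knaf, F.-V. Kuhlmann, *Every place admits local uniformization in a finite
  extension of the function field*, Adv. Math. 221 (2009), Thm. 1.5.
* [Cutkosky2014] S. D. Cutkosky, counterexample paper, §2.1–2.2 (quadratic transforms along a
  valuation), as vendored in `Resolution/QuadraticTransforms.lean`.
-/

namespace Literature.AlgebraicGeometry.CossartPiltant200819.CP2008

open Literature.AlgebraicGeometry.Resolution
open scoped Pointwise IntermediateField
open IsLocalRing

universe u

/-! ### The named fact: uniformization along the arc of a discrete valuation ring -/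

/-- NAMED FACT — **Benito–Piltant–Reguera 2022, Proposition 2.3 (Uniformization along arcs)**,
for the arc of a discrete valuation ring of the function field: "Let `P ∈ X_∞`. Assume that
`h_P` is a nonconstant arc and `h_P(η) ∉ Sing X`. Consider the quadratic sequence (2.2) … Then
both `Γ(h^{(r)}_P)` and `X^{(r)}` are regular at `x^{(r)}` for every `r ≫ 0`" (`X` a variety over
a PERFECT field `k`, §2, HAL p. 4).  Rendered (module docstring): for `k` perfect, `K/k` finitely
generated, `O ⊇ k` a discrete valuation ring of `K` and `R₀` a local model of `O`, some finite
chain `R₀ → R₁ → ⋯ → R_n` of quadratic transforms along `O` (the local rings at the centres of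
`O` of the quadratic sequence of `X = Spec A` along the arc `𝒪_X → Ô ≅ κ(O)[[t]]`, `A` an affine
model of `R₀`) ends at a local uniformization `R_n` of `O`.  Hypothesis only.
[cite: BenitoPiltantReguera2022, Prop. 2.3 (HAL hal-01945228v1 p. 7)] -/
def BenitoPiltantReguera2022QuadraticSequence : Prop :=
  ∀ (k K : Type u) [Field k] [Field K] [Algebra k K], PerfectField k →
    (⊤ : IntermediateField k K).FG →
    ∀ (O : ValuationSubring K), (∀ c : k, algebraMap k K c ∈ O) →
      IsDiscreteValuationRing O →
      ∀ R₀ : Subalgebra k K, IsLocalModelOf k K O R₀ →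
        ∃ (n : ℕ) (R : ℕ → Subalgebra k K), R 0 = R₀ ∧
          (∀ i < n, IsQuadraticTransformAlong O (R i).toSubring (R (i + 1)).toSubring) ∧
          IsLocalUniformizationOf k K O (R n)

/-! ### Local models: the local ring of `O` on an affine model -/

section LocModel

variable {k K : Type u} [Field k] [Field K] [Algebra k K] (O : ValuationSubring K)

/-- The local ring of `O` on an affine model `A ⊆ O` (`Frac A = K`) is a local model of `O` —
definitional unfolding of `IsLocalModelOf`. [cite: CossartPiltant2008, Section 3 (HAL p. 4)] -/
theorem isLocalModelOf_locModel {A : Subalgebra k K} (hAfg : A.FG) [IsFractionRing A K]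
    (hAO : A.toSubring ≤ O.toSubring) : IsLocalModelOf k K O (locModel O A) :=
  ⟨A, hAfg, ‹_›, hAO, coe_locModel O A⟩

/-- The local ring of `O` on `B`, as a subring, is the tree's `locAtCentre B O`
(`Resolution/LocalBlowup.lean`). [folklore] -/
theorem locModel_toSubring (B : Subalgebra k K) :
    (locModel O B).toSubring = locAtCentre B.toSubring O := by
  ext x
  simp only [Subalgebra.mem_toSubring, mem_locModel_iff, mem_locAtCentre_iff, div_eq_mul_inv]

/-- **Local uniformization of discrete valuation rings over a perfect field** [BPR 2022,
Prop. 2.3]: for `k` perfect and `K/k` finitely generated, every discrete valuation ring `O ⊇ k`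
of `K` — any dimension, characteristic and residue field — is locally uniformizable
(`Resolution.IsLocallyUniformizable`): run the fact from the local ring of `O` on an affine model
(`Resolution.exists_affineModel`). PROVED from the named fact.
[cite: BenitoPiltantReguera2022, Prop. 2.3 (HAL hal-01945228v1 p. 7)] -/
theorem isLocallyUniformizable_of_isDiscreteValuationRing
    (hBPR : BenitoPiltantReguera2022QuadraticSequence.{u}) [PerfectField k]
    (hfg : (⊤ : IntermediateField k K).FG) (hk : ∀ c : k, algebraMap k K c ∈ O)
    (hO : IsDiscreteValuationRing O) : IsLocallyUniformizable k K O := by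
  obtain ⟨A, hAO, hAfg, hAfrac⟩ := exists_affineModel k K hfg O hk
  haveI := hAfrac
  obtain ⟨n, R, -, -, hLU⟩ :=
    hBPR k K ‹_› hfg O hk hO (locModel O A) (isLocalModelOf_locModel O hAfg hAO)
  exact hLU.isLocallyUniformizable

end LocModel

/-! ### Equivariance of quadratic transforms along an invariant valuation -/

section Equivariance

variable {K L : Type u} [Field K] [Field L] [Algebra K L] (W : ValuationSubring L)
  {σ : L ≃ₐ[K] L}

/-- `σW = W ⇒ (σx ∈ W ⟺ x ∈ W)`. [folklore] -/
theorem map_mem_iff_of_smul_eq (hσ : σ • W = W) (x : L) : σ x ∈ W ↔ x ∈ W := by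
  refine ⟨fun h => ?_, map_mem_of_smul_eq W σ hσ⟩
  have h' := map_mem_of_smul_eq W σ⁻¹ (inv_smul_eq_iff.mpr hσ.symm) h
  rwa [AlgEquiv.aut_inv, AlgEquiv.symm_apply_apply] at h'

/-- `σW = W ⇒ (W(σa) ≥ W(σb) ⟺ W(a) ≥ W(b))` (multiplicatively: `≤` of valuations). [folklore] -/
theorem valuation_map_le_iff (hσ : σ • W = W) (a b : L) :
    W.valuation (σ a) ≤ W.valuation (σ b) ↔ W.valuation a ≤ W.valuation b := by
  by_cases hb : b = 0
  · subst hb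
    simp
  · have hb' : σ b ≠ 0 := (EmbeddingLike.map_ne_zero_iff).mpr hb
    have h₁ : W.valuation a ≤ W.valuation b ↔ a / b ∈ W := by
      rw [← W.valuation_le_one_iff, map_div₀,
        div_le_one₀ (pos_iff_ne_zero.mpr ((map_ne_zero _).mpr hb))]
    have h₂ : W.valuation (σ a) ≤ W.valuation (σ b) ↔ σ (a / b) ∈ W := by
      rw [← W.valuation_le_one_iff, map_div₀, map_div₀,
        div_le_one₀ (pos_iff_ne_zero.mpr ((map_ne_zero _).mpr hb'))]
    rw [h₁, h₂, map_mem_iff_of_smul_eq W hσ]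

/-- `σW = W ⇒ (W(σx) > 0 ⟺ W(x) > 0)` (multiplicatively: value `< 1`). [folklore] -/
theorem valuation_map_lt_one_iff (hσ : σ • W = W) (x : L) :
    W.valuation (σ x) < 1 ↔ W.valuation x < 1 := by
  have h := valuation_map_le_iff W hσ 1 x
  rw [map_one, map_one] at h
  constructor
  · intro hlt
    by_contra hge
    exact (not_le.mpr hlt) (h.mpr (not_lt.mp hge))
  · intro hlt
    by_contra hge
    exact (not_le.mpr hlt) (h.mp (not_lt.mp hge))

/-- Transport of the localisation at the centre: `σ((B)_{𝔪_W ∩ B}) = (σB)_{𝔪_W ∩ σB}` for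
`σW = W`. [folklore] -/
theorem map_locAtCentre (hσ : σ • W = W) (B : Subring L) :
    (locAtCentre B W).map (σ : L →+* L) = locAtCentre (B.map (σ : L →+* L)) W := by
  ext x
  simp only [Subring.mem_map, mem_locAtCentre_iff, RingHom.coe_coe]
  constructor
  · rintro ⟨y, ⟨a, ha, b, hb, hvb, rfl⟩, rfl⟩
    exact ⟨σ a, ⟨a, ha, rfl⟩, σ b, ⟨b, hb, rfl⟩, (valuation_map_eq_one_iff W hσ b).mpr hvb,
      by rw [map_div₀]⟩
  · rintro ⟨_, ⟨a, ha, rfl⟩, _, ⟨b, hb, rfl⟩, hvb, rfl⟩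
    exact ⟨a / b, ⟨a, ha, b, hb, (valuation_map_eq_one_iff W hσ b).mp hvb, rfl⟩,
      by rw [map_div₀]⟩

/-- Transport of the blow-up ring `R[𝔪_R/x]` of a `σ`-stable local ring dominated by the
`σ`-stable `W`: `σ(R[𝔪_R/x]) = R[𝔪_R/σx]` (`σ𝔪_R = 𝔪_R` as `𝔪_R = 𝔪_W ∩ R`). [folklore] -/
theorem map_blowupRing (hσ : σ • W = W) {R : Subring L} [IsLocalRing R]
    (hdom : SubringDominates R W.toSubring) (hR : R.map (σ : L →+* L) = R) (x : L) :
    (blowupRing R x).map (σ : L →+* L) = blowupRing R (σ x) := by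
  have hmax : ∀ a : R, a ∈ maximalIdeal R ↔ W.valuation (a : L) < 1 :=
    (subringDominates_valuationSubring_iff hdom.1).mp hdom
  have hσR : ∀ y ∈ R, σ y ∈ R := fun y hy =>
    hR.le (Subring.mem_map.mpr ⟨y, hy, rfl⟩)
  have hσR' : ∀ y ∈ R, ∃ z ∈ R, σ z = y := fun y hy => by
    obtain ⟨z, hz, hzy⟩ := Subring.mem_map.mp (hR.ge hy)
    exact ⟨z, hz, hzy⟩
  rw [blowupRing, blowupRing, RingHom.map_closure]
  congr 1
  rw [Set.image_union]
  congr 1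
  · rw [← Subring.coe_map, hR]
  · ext z
    simp only [Set.mem_image, SetLike.mem_coe, RingHom.coe_coe]
    constructor
    · rintro ⟨_, ⟨y, hy, rfl⟩, rfl⟩
      refine ⟨⟨σ y, hσR _ y.2⟩, (hmax _).mpr ?_, by rw [map_div₀]⟩
      exact (valuation_map_lt_one_iff W hσ _).mpr ((hmax y).mp hy)
    · rintro ⟨y, hy, rfl⟩
      obtain ⟨z, hz, hzy⟩ := hσR' y y.2
      refine ⟨(z : L) / x, ⟨⟨z, hz⟩, (hmax _).mpr ?_, rfl⟩, by rw [map_div₀, hzy]⟩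
      have h := (hmax y).mp hy
      rw [← hzy] at h
      exact (valuation_map_lt_one_iff W hσ z).mp h

/-- The quadratic transform along `O` given by a nonzero generator of `𝔪_R` of minimal value
(the unfolding of `IsQuadraticTransformAlong` run backwards). [cite: Cutkosky2014, §2.2] -/
theorem isQuadraticTransformAlong_blowupRing {O : ValuationSubring L} {R : Subring L}
    [IsLocalRing R] (hRO : R ≤ O.toSubring) (hfg : (maximalIdeal R).FG) {x : R}
    (hx : x ∈ maximalIdeal R) (h0 : x ≠ 0)
    (hmin : ∀ y ∈ maximalIdeal R, O.valuation (y : L) ≤ O.valuation (x : L)) :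
    IsQuadraticTransformAlong O R (locAtCentre (blowupRing R (x : L)) O) := by
  classical
  obtain ⟨s, hs⟩ := hfg
  have hspan : Ideal.span (↑(insert x s) : Set R) = maximalIdeal R := by
    rw [Finset.coe_insert, Ideal.span_insert, hs, sup_eq_right]
    exact (Ideal.span_singleton_le_iff_mem _).mpr hx
  refine ⟨‹_›, hRO, insert x s, x, hspan, Finset.mem_insert_self _ _, h0, fun y hy =>
    hmin y (hspan ▸ Ideal.subset_span (Finset.mem_coe.mpr hy)), ?_⟩
  rw [blowupRing_eq_closure_of_span_eq (x : L) _ hspan]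

/-- **Equivariance of quadratic transforms along an invariant valuation**: let `σ ∈ Aut(L/K)`
fix the valuation ring `W` and the local ring `R ⊆ W` dominated by `W`; then `σ` fixes the
quadratic transform `R₁` of `R` along `W`.  Indeed `σR₁ = (R[𝔪_R/σx])_{𝔪_W ∩ …}` is again a
quadratic transform of `R` along `W` (`σx ∈ 𝔪_R` has minimal value as `x` does), and the
quadratic transform along `W` is unique (`IsQuadraticTransformAlong.unique`).  PROVED; this is
the equivariance of the quadratic sequence of [BPR 2022] (2.2) along a `G`-invariant arc.
[cite: Cutkosky2014, §2.2; BenitoPiltantReguera2022, Def. 2.1 (HAL hal-01945228v1 p. 6)] -/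
theorem quadraticTransform_map_eq_self (hσ : σ • W = W) {R R₁ : Subring L}
    (h : IsQuadraticTransformAlong W R R₁) (hdom : SubringDominates R W.toSubring)
    (hR : R.map (σ : L →+* L) = R) : R₁.map (σ : L →+* L) = R₁ := by
  obtain ⟨hloc, x, hx, h0, hmin, rfl⟩ := h.exists_eq_locAtCentre
  obtain ⟨_, hfg⟩ := h.fg_maximalIdeal
  have hmax : ∀ a : R, a ∈ maximalIdeal R ↔ W.valuation (a : L) < 1 :=
    (subringDominates_valuationSubring_iff hdom.1).mp hdom
  have hσR : ∀ y ∈ R, σ y ∈ R := fun y hy =>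
    hR.le (Subring.mem_map.mpr ⟨y, hy, rfl⟩)
  have hσR' : ∀ y ∈ R, ∃ z ∈ R, σ z = y := fun y hy => by
    obtain ⟨z, hz, hzy⟩ := Subring.mem_map.mp (hR.ge hy)
    exact ⟨z, hz, hzy⟩
  let x' : R := ⟨σ (x : L), hσR _ x.2⟩
  have hx' : x' ∈ maximalIdeal R :=
    (hmax x').mpr ((valuation_map_lt_one_iff W hσ _).mpr ((hmax x).mp hx))
  have h0' : x' ≠ 0 := by
    intro e
    apply h0
    have e' : σ (x : L) = 0 := congrArg Subtype.val e
    exact Subtype.ext ((EmbeddingLike.map_eq_zero_iff).mp e')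
  have hmin' : ∀ y ∈ maximalIdeal R, W.valuation (y : L) ≤ W.valuation (x' : L) := by
    intro y hy
    obtain ⟨z, hz, hzy⟩ := hσR' y y.2
    have hzm : (⟨z, hz⟩ : R) ∈ maximalIdeal R := by
      refine (hmax _).mpr ?_
      have h := (hmax y).mp hy
      rw [← hzy] at h
      exact (valuation_map_lt_one_iff W hσ z).mp h
    have h := hmin ⟨z, hz⟩ hzm
    rw [← valuation_map_le_iff W hσ] at h
    change W.valuation (σ z) ≤ W.valuation (σ x) at h
    rw [hzy] at h
    exact h
  have h' : IsQuadraticTransformAlong W R (locAtCentre (blowupRing R (x' : L)) W) :=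
    isQuadraticTransformAlong_blowupRing h.source_le hfg hx' h0' hmin'
  rw [map_locAtCentre W hσ, map_blowupRing W hσ hdom hR]
  exact h'.unique h

end Equivariance

/-! ### (S3\*) in the discrete case over a perfect ground field -/

section Discrete

variable {k K : Type u} [Field k] [Field K] [Algebra k K]
  {L : Type u} [Field L] [Algebra K L] [Algebra k L] [IsScalarTower k K L]

/-- **`Aut(L/K)`-saturation of an affine model**: for `L/K` finite and `W` fixed by every
`σ ∈ Aut(L/K)`, a finitely generated `k`-subalgebra `A ⊆ W` lies in a finitely generated
`k`-subalgebra `B ⊆ W` with `σB = B` for all `σ` (adjoin all conjugates of the generators).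
[folklore] -/
theorem exists_fg_stable_ge [FiniteDimensional K L] (W : ValuationSubring L)
    (hk : ∀ c : k, algebraMap k L c ∈ W) (hGW : ∀ σ : L ≃ₐ[K] L, σ • W = W)
    {A : Subalgebra k L} (hAfg : A.FG) (hAW : A.toSubring ≤ W.toSubring) :
    ∃ B : Subalgebra k L, B.FG ∧ A ≤ B ∧ B.toSubring ≤ W.toSubring ∧
      ∀ σ : L ≃ₐ[K] L, B.toSubring.map (σ : L →+* L) = B.toSubring := by
  classical
  obtain ⟨t, ht⟩ := hAfg
  let gens : Finset L := Finset.univ.biUnion fun τ : L ≃ₐ[K] L => t.image fun g => τ g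
  have hgens : ∀ (τ : L ≃ₐ[K] L), ∀ g ∈ t, τ g ∈ (gens : Set L) := fun τ g hg =>
    Finset.mem_coe.mpr (Finset.mem_biUnion.mpr
      ⟨τ, Finset.mem_univ _, Finset.mem_image.mpr ⟨g, hg, rfl⟩⟩)
  have hAt : ∀ g ∈ t, g ∈ A := fun g hg => ht ▸ Algebra.subset_adjoin (Finset.mem_coe.mpr hg)
  set B : Subalgebra k L := Algebra.adjoin k (gens : Set L) with hB
  have hle : ∀ τ : L ≃ₐ[K] L, B.toSubring.map (τ : L →+* L) ≤ B.toSubring := by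
    intro τ x hx
    obtain ⟨y, hy, rfl⟩ := Subring.mem_map.mp hx
    let τ' : L →ₐ[k] L := ((τ.restrictScalars k : L ≃ₐ[k] L) : L →ₐ[k] L)
    have hτ' : ∀ z, τ' z = τ z := fun _ => rfl
    have hmap : B.map τ' ≤ B := by
      rw [hB, AlgHom.map_adjoin]
      refine Algebra.adjoin_mono ?_
      rintro _ ⟨g, hg, rfl⟩
      obtain ⟨ρ, -, hg'⟩ := Finset.mem_biUnion.mp (Finset.mem_coe.mp hg)
      obtain ⟨g₀, hg₀, rfl⟩ := Finset.mem_image.mp hg'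
      rw [hτ', ← AlgEquiv.mul_apply]
      exact hgens (τ * ρ) g₀ hg₀
    have hyB : τ y ∈ B.map τ' := Subalgebra.mem_map.mpr ⟨y, hy, rfl⟩
    exact hmap hyB
  refine ⟨B, ⟨gens, rfl⟩, ?_, ?_, fun σ => le_antisymm (hle σ) fun x hx => ?_⟩
  · rw [← ht]
    exact Algebra.adjoin_le fun g hg => Algebra.subset_adjoin (hgens 1 g (Finset.mem_coe.mp hg))
  · have h : B ≤ valuationSubalgebra W hk := by
      refine Algebra.adjoin_le fun x hx => ?_
      obtain ⟨τ, -, hx'⟩ := Finset.mem_biUnion.mp (Finset.mem_coe.mp hx)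
      obtain ⟨g, hg, rfl⟩ := Finset.mem_image.mp hx'
      exact (mem_valuationSubalgebra W hk _).mpr
        (map_mem_of_smul_eq W τ (hGW τ) (hAW (hAt g hg)))
    exact fun x hx => (mem_valuationSubalgebra W hk x).mp (h hx)
  · have hx' : σ⁻¹ x ∈ B.toSubring := hle σ⁻¹ (Subring.mem_map.mpr ⟨x, hx, rfl⟩)
    refine Subring.mem_map.mpr ⟨σ⁻¹ x, hx', ?_⟩
    rw [RingHom.coe_coe, AlgEquiv.aut_inv, AlgEquiv.apply_symm_apply]

/-- **(S3\*) in the discrete case over a perfect ground field** [BPR 2022, Prop. 2.3 +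
equivariance]: let `k` be perfect, `K/k` finitely generated, `L/K` finite, `W ⊇ k` a DISCRETE
valuation ring of `L` with `σW = W` for every `σ ∈ Aut(L/K)`, and `R₀` a normal local model of
`V = W ∩ K`.  Then `W` has a local uniformization `S ⊇ R̃₀` with `σS = S` for all `σ` — the
statement (S3\*) of HAL p. 30 l. 14–16 in this case (no inertia / primality / rank hypothesis
needed): the quadratic sequence along `W` started at the local ring of `W` on the
`Aut(L/K)`-saturation of an affine model of a local model `T ⊇ R̃₀` (`normalModelAboveLe_holds`)
consists of `Aut(L/K)`-stable local rings (`quadraticTransform_map_eq_self`) and reaches a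
regular one by the named fact.  PROVED from the named fact.
[cite: BenitoPiltantReguera2022, Prop. 2.3 (HAL hal-01945228v1 p. 7); CossartPiltant2008, Lemma 9.4 proof (HAL p. 30, l. 14-16)] -/
theorem gStableUniformizationAbove_of_isDiscreteValuationRing
    (hBPR : BenitoPiltantReguera2022QuadraticSequence.{u}) [PerfectField k]
    [FiniteDimensional K L] (hfg : (⊤ : IntermediateField k K).FG)
    (W : ValuationSubring L) (hk : ∀ c : k, algebraMap k L c ∈ W)
    (hW : IsDiscreteValuationRing W) (hGW : ∀ σ : L ≃ₐ[K] L, σ • W = W)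
    (R₀ : Subalgebra k K) (hR₀ : IsNormalLocalModelOf k K (W.comap (algebraMap K L)) R₀) :
    GStableUniformizationAbove (K := K) W R₀ := by
  classical
  have hfgL : (⊤ : IntermediateField k L).FG := intermediateField_fg_top_of_finite hfg
  -- a local model `T ⊇ R̃₀` of `W` with affine model `A`
  obtain ⟨T, ⟨A, hAfg, hAfrac, hAW, hTset⟩, hRT⟩ :=
    normalModelAboveLe_holds k K hfg L ‹_› W hk R₀ hR₀
  haveI := hAfrac
  -- the `Aut(L/K)`-saturation `B ⊇ A`; the local ring `E` of `W` on `B` is a local model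
  obtain ⟨B, hBfg, hAB, hBW, hBσ⟩ := exists_fg_stable_ge W hk hGW hAfg hAW
  haveI hBfrac : IsFractionRing B L := IsFractionRing.of_field B L fun z => by
    obtain ⟨a, b, -, rfl⟩ := IsFractionRing.div_surjective (A := A) z
    exact ⟨⟨a, hAB a.2⟩, ⟨b, hAB b.2⟩, rfl⟩
  have hE : IsLocalModelOf k L W (locModel W B) := isLocalModelOf_locModel W hBfg hBW
  -- the quadratic sequence along `W` from `E` ends at a local uniformization [BPR 2022, 2.3]
  obtain ⟨n, R, hR0, hchain, hLU⟩ := hBPR k L ‹_› hfgL W hk hW (locModel W B) hE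
  -- along the chain: dominated by `W`, above `E`, `Aut(L/K)`-stable
  have key : ∀ i, i ≤ n → SubringDominates (R i).toSubring W.toSubring ∧ locModel W B ≤ R i ∧
      ∀ σ : L ≃ₐ[K] L, (R i).toSubring.map (σ : L →+* L) = (R i).toSubring := by
    intro i
    induction i with
    | zero =>
      intro _
      rw [hR0]
      refine ⟨?_, le_rfl, fun σ => ?_⟩
      · rw [locModel_toSubring]
        exact subringDominates_locAtCentre hBW
      · rw [locModel_toSubring, map_locAtCentre W (hGW σ), hBσ σ]
    | succ i ih =>
      intro hi
      obtain ⟨hdom, hle, hstab⟩ := ih (Nat.le_of_succ_le hi)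
      have hq := hchain i (Nat.lt_of_succ_le hi)
      exact ⟨hq.dominated, hle.trans fun x hx => hq.le hx,
        fun σ => quadraticTransform_map_eq_self W (hGW σ) hq hdom (hstab σ)⟩
  obtain ⟨-, hle, hstab⟩ := key n le_rfl
  have hTE : (T : Set L) ⊆ (locModel W B : Set L) := by
    rw [hTset]
    exact fun x hx => locModel_mono W hAB ((mem_locModel_iff W A).mpr hx)
  refine ⟨R n, hLU, hRT.trans (hTE.trans fun x hx => hle hx), fun σ => ?_⟩
  have h := congrArg (fun S : Subring L => (S : Set L)) (hstab σ)
  simpa only [Subring.coe_map, RingHom.coe_coe, Subalgebra.coe_toSubring] using h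

end Discrete

/-! ### The residual split along "`W` discrete / `k` perfect" -/

/-- **(S3\*) in rational rank one, NON-DISCRETE sub-case**: the residual
`GStableUniformizationInertialRankOne` (HAL p. 30, l. 14–16 for inertial rank-one `W` of the
setting of Lemma 9.4 with `rat.rk W < 2`) restricted to those `W` which are NOT discrete
valuation rings (value group a non-discrete rank-one group of rational rank one).  This is the
genuinely open part of the residual — not established by the printed text, by [Fu1997], by
[KnafKuhlmann2009] or by [BenitoPiltantReguera2022]; hypothesis only (pub-hironaka GAPS rows
G7-A21.S, G9-A21.S-R (i), rider G22-A21.S-Q).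
[cite: CossartPiltant2008, Lemma 9.4 proof (HAL p. 30, l. 11–16)] -/
def GStableUniformizationInertialRankOneNonDiscrete : Prop :=
  ∀ (k K : Type u) [Field k] [Field K] [Algebra k K], (⊤ : IntermediateField k K).FG →
    Algebra.trdeg k K = 3 →
    ∀ (L : Type u) [Field L] [Algebra K L] [Algebra k L] [IsScalarTower k K L],
      FiniteDimensional K L → IsGalois K L →
      (Module.finrank K L).Prime → ((Module.finrank K L : ℕ) : K) ≠ 0 →
      ∀ (W : ValuationSubring L) (hk : ∀ c : k, algebraMap k L c ∈ W),
        Nonempty W.valuation.RankOne → residueTrdeg k W hk = 0 → ratRank W < 2 →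
          (∀ σ : L ≃ₐ[K] L, InInertiaGroup K W σ) →
          IsLocallyUniformizable k L W →
          ¬ IsDiscreteValuationRing W →
          ∀ R₀ : Subalgebra k K, IsNormalLocalModelOf k K (W.comap (algebraMap K L)) R₀ →
            GStableUniformizationAbove (K := K) W R₀

/-- **(S3\*) in rational rank one, DISCRETE sub-case over an IMPERFECT ground field**: the
residual `GStableUniformizationInertialRankOne` restricted to discrete `W` and non-perfect `k`
(for perfect `k` it is `gStableUniformizationAbove_of_isDiscreteValuationRing`).  Hypothesis
only; in universe `0` it shrinks further by [KnafKuhlmann2009] Thm. 1.5, see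
`DiscreteDescent2008.lean` (pub-hironaka GAPS rider G22-A21.S-Q).
[cite: CossartPiltant2008, Lemma 9.4 proof (HAL p. 30, l. 11–16)] -/
def GStableUniformizationInertialRankOneDiscreteImperfect : Prop :=
  ∀ (k K : Type u) [Field k] [Field K] [Algebra k K], (⊤ : IntermediateField k K).FG →
    Algebra.trdeg k K = 3 →
    ∀ (L : Type u) [Field L] [Algebra K L] [Algebra k L] [IsScalarTower k K L],
      FiniteDimensional K L → IsGalois K L →
      (Module.finrank K L).Prime → ((Module.finrank K L : ℕ) : K) ≠ 0 →
      ∀ (W : ValuationSubring L) (hk : ∀ c : k, algebraMap k L c ∈ W),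
        Nonempty W.valuation.RankOne → residueTrdeg k W hk = 0 → ratRank W < 2 →
          (∀ σ : L ≃ₐ[K] L, InInertiaGroup K W σ) →
          IsLocallyUniformizable k L W →
          IsDiscreteValuationRing W → ¬ PerfectField k →
          ∀ R₀ : Subalgebra k K, IsNormalLocalModelOf k K (W.comap (algebraMap K L)) R₀ →
            GStableUniformizationAbove (K := K) W R₀

/-- The non-discrete sub-case is a weakening of the residual. [folklore] -/
theorem GStableUniformizationInertialRankOne.nonDiscrete
    (h : GStableUniformizationInertialRankOne.{u}) :
    GStableUniformizationInertialRankOneNonDiscrete.{u} :=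
  fun k K _ _ _ hfg htr L _ _ _ _ hfd hgal hpr hl W hk hrk hres hrr hin hLU _ R₀ hR₀ =>
    h k K hfg htr L hfd hgal hpr hl W hk hrk hres hrr hin hLU R₀ hR₀

/-- The discrete-imperfect sub-case is a weakening of the residual. [folklore] -/
theorem GStableUniformizationInertialRankOne.discreteImperfect
    (h : GStableUniformizationInertialRankOne.{u}) :
    GStableUniformizationInertialRankOneDiscreteImperfect.{u} :=
  fun k K _ _ _ hfg htr L _ _ _ _ hfd hgal hpr hl W hk hrk hres hrr hin hLU _ _ R₀ hR₀ =>
    h k K hfg htr L hfd hgal hpr hl W hk hrk hres hrr hin hLU R₀ hR₀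

/-- **The residual (S3\*) in rational rank one splits** (PROVED bookkeeping): it follows from
[BPR 2022, Prop. 2.3] (for `W` discrete and `k` perfect:
`gStableUniformizationAbove_of_isDiscreteValuationRing`, the inertia hypothesis supplying
`σW = W`) and its two sub-cases "`W` not discrete" and "`W` discrete, `k` imperfect".
[cite: CossartPiltant2008, Lemma 9.4 proof (HAL p. 30, l. 11–16); BenitoPiltantReguera2022, Prop. 2.3 (HAL hal-01945228v1 p. 7)] -/
theorem gStableUniformizationInertialRankOne_of_cases
    (hBPR : BenitoPiltantReguera2022QuadraticSequence.{u})
    (hnd : GStableUniformizationInertialRankOneNonDiscrete.{u})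
    (hdi : GStableUniformizationInertialRankOneDiscreteImperfect.{u}) :
    GStableUniformizationInertialRankOne.{u} := by
  intro k K _ _ _ hfg htr L _ _ _ _ hfd hgal hpr hl W hk hrk hres hrr hin hLU R₀ hR₀
  by_cases hW : IsDiscreteValuationRing W
  · by_cases hp : PerfectField k
    · haveI := hp
      haveI := hfd
      exact gStableUniformizationAbove_of_isDiscreteValuationRing hBPR hfg W hk hW
        (fun σ => by
          obtain ⟨hσ, -⟩ := hin σ
          exact MulAction.mem_stabilizer_iff.mp hσ) R₀ hR₀
    · exact hdi k K hfg htr L hfd hgal hpr hl W hk hrk hres hrr hin hLU hW hp R₀ hR₀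
  · exact hnd k K hfg htr L hfd hgal hpr hl W hk hrk hres hrr hin hLU hW R₀ hR₀

/-- **Lemma 9.4 (`TamePrimeDescent`) over an arbitrary ground field from the printed leaves,
the transport, [BPR 2022, Prop. 2.3] and the two sub-cases of the rank-one residual** (PROVED
bookkeeping): `TamePrimeDescentAssembly2008.tamePrimeDescent_of_printed_leaves` with its last
hypothesis `GStableUniformizationInertialRankOne` split by
`gStableUniformizationInertialRankOne_of_cases`.
[cite: CossartPiltant2008, Lemma 9.4 (HAL p. 29–30); BenitoPiltantReguera2022, Prop. 2.3 (HAL hal-01945228v1 p. 7)] -/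
theorem tamePrimeDescent_of_printed_leaves_cases (h93 : DescentBelowInertiaField.{u})
    (h₁ : TamePrimeDescentViaStableModel.{u}) (hcof : Cofinality.{u})
    (hFu : PrimaryTransformRankOne.{u}) (hBPR : BenitoPiltantReguera2022QuadraticSequence.{u})
    (hnd : GStableUniformizationInertialRankOneNonDiscrete.{u})
    (hdi : GStableUniformizationInertialRankOneDiscreteImperfect.{u}) : TamePrimeDescent.{u} :=
  tamePrimeDescent_of_printed_leaves h93 h₁ hcof hFu
    (gStableUniformizationInertialRankOne_of_cases hBPR hnd hdi)


end Literature.AlgebraicGeometry.CossartPiltant200819.CP2008
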